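import Summits.BirchSwinnertonDyer.BirchSwinnertonDyer.Theorems.SignedLowerHalvesSmallImageLowerHalfBothSignsRttD2SeqJ3LambdaPairing
import Summits.BirchSwinnertonDyer.BirchSwinnertonDyer.Theorems.SignedLowerHalvesSmallImageLowerHalfBothSignsRttD2SeqJ3CofreePairing
import Summits.BirchSwinnertonDyer.BirchSwinnertonDyer.Theorems.SignedLowerHalvesSmallImageLowerHalfBothSignsRttD2SeqJ3TorsionLevels
import Literature.NumberTheory.EllipticCurves.GreenbergSelmerCofreeReductionPk
import HarnessLib

/-!
# Route `SignedLowerHalves`, crux L `SmallImageLowerHalfBothSigns` (stmt-BirchSwinnertonDyer-23599), line `rtt_w3` v14 → v15 — E2, row J3 (Galois side, part β₃d′, stage 2 — GENERAL LINEAR FORM `λ`):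
# THE `λ`-PAIRING ON THE TORSION LEVELS `M[p^k]` OF THE LEAD's MODULE `M = (F/𝒪)(θ) = GreenbergSelmer.Cofree θ F` (rank one):
# `M[p^k] = p^{-k}𝒪/𝒪 ≅ 𝒪/p^k` (coordinates), `⟪w, m⟫_k := Tr(a·x)·ζ` for `w = a ⊗ ζ`, `m = x/p^k`; its `𝒪`-balance, level law and Galois twist law

WIDTH seat `bsd-line-slh-p3-w3` g22 under LEAD `cruxlead-stmt-BirchSwinnertonDyer-23599` g11 (cell `bsd-ssimc`); helper `--supports stmt-BirchSwinnertonDyer-23599`.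
DEFINITIONS WITH BODIES + THEOREMS; no named fact, no instance, no `sorry`. HONEST FRAMING: `λ`-parametrised twin of p791577 (the perfectness-safe normalisation); stage 2 of input (β₃d) for `exists_junction_exact_of_inputs` (p790304) — the coefficient
pairing on the torsion level `M[p^k]` of the LEAD's `M = Cofree θ (padicCoeffField S)` (`θ : FramedGaloisRep K 𝒪 1`, consumer p784278); stage 3 (packaging as the `ContPairing`
binder `Pk` over `Γ_{K_v}` with `hPred`/`hPsc`) is the sequel. E2, crux L/M, BSD remain OPEN and are proved for NO curve.

* §1 coordinates of `M[p^k]`: `exists_divPowTors_eq` (every `p^k`-torsion class is `t/p^k`), `exists_eq_pow_mul_of_divPowCofreeMk_eq_zero` (`t/p^k ≡ 0 ⇒ t ∈ p^k𝒪`),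
  `lamPairing_eq_of_divPowCofreeMk_eq` (the trace pairing only depends on `t/p^k`).
* §2 ★ `cofreeLamPairing S K lam hlam θ k : OMuCarrier K S (p^k) →+ (M[p^k] →+ μ_{p^k})`, `cofreeLamPairing_divPowTors` (`= Tr(a t)·ζ` on `t/p^k`).
* §3 laws: ★ `cofreeLamPairing_oMuScalar` (`𝒪`-balance, the shape of `hPsc`), ★ `muInclusion_cofreeLamPairing_oMuRed` (level law, the shape of `hPred`),
  ★ `cofreeLamPairing_muTwistO_smul` (Galois: `⟪σ·w, σ·m⟫ = σ·⟪w, m⟫` whenever `θ′(σ)·θ(σ) = 1`).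
References: [Rubin2000] §4.2; [NeukirchSchmidtWingberg2008] (7.2.6); [Kato2004Asterisque] §13.8; [Greenberg1989] §1; [EmertonPollackWeston2006] §3.1.
-/

set_option autoImplicit false
set_option linter.dupNamespace false -- D-0017: single-problem summit, the namespace repeats the problem name by design
noncomputable section

open scoped Classical
open NumberField IsDedekindDomain Field Matrix

namespace Summit.BirchSwinnertonDyer.BirchSwinnertonDyer.Theorems.SmallImageRttD2Seq

open Literature.NumberTheory.EllipticCurves Literature.NumberTheory.EllipticCurves.GreenbergSelmer Literature.NumberTheory.GaloisRepresentations
  Literature.NumberTheory.GaloisRepresentations.DiscreteGaloisModule Literature.NumberTheory.ComplexMultiplication.EllipticUnits.JohnsonLeungKings2011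

section Cofree

variable {p : ℕ} [Fact p.Prime] (S : Set (PadicAlgCl p)) (K : Type) [Field K] (lam : padicCoeffIntegers S →+ ℤ_[p])
  (hlam : ∀ (c : ℤ_[p]) (y : padicCoeffIntegers S), lam (padicIntToCoeffIntegers S c * y) = c * lam y) (θ : FramedGaloisRep K (padicCoeffIntegers S) 1) (k : ℕ)

include hlam

/-! ## §1. The `λ`-pairing only depends on `t/p^k` -/

/-- The trace pairing (stage 1, p791019) depends on `t ∈ 𝒪` only through `t/p^k ∈ F/𝒪`. [cite: Rubin2000, §4.2] -/
theorem lamPairing_eq_of_divPowCofreeMk_eq (w : OMuCarrier K S (p ^ k)) (t t' : Fin 1 → padicCoeffIntegers S)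
    (h : divPowCofreeMk S θ k t = divPowCofreeMk S θ k t') : lamPairing S K lam k w (t 0) = lamPairing S K lam k w (t' 0) := by
  have h0 : divPowCofreeMk S θ k (t - t') = 0 := by rw [map_sub, h, sub_self]
  obtain ⟨s, hs⟩ := exists_eq_pow_mul_of_divPowCofreeMk_eq_zero S K θ k (t - t') h0
  rw [← sub_eq_zero, ← map_sub, show t 0 - t' 0 = (t - t') 0 from rfl, hs, lamPairing_natCast_pow_mul S K lam hlam]

/-! ## §2. The pairing on `M[p^k]` -/

/-- ★ **The trace pairing on the torsion level `M[p^k] = (p^{-k}𝒪/𝒪)(θ)`**: `⟪a ⊗ ζ, t/p^k⟫_k = Tr_{𝒪/ℤ_p}(a t)·ζ`. [cite: Rubin2000, §4.2] [cite: NeukirchSchmidtWingberg2008, (7.2.6)] -/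
def cofreeLamPairing : OMuCarrier K S (p ^ k) →+ (↥(torsionPow (Cofree θ (padicCoeffField S)) p k) →+ MuCarrier K (p ^ k)) where
  toFun w :=
    { toFun := fun m ↦ lamPairing S K lam k w (torsCoord S K θ k m 0)
      map_zero' := by
        rw [lamPairing_eq_of_divPowCofreeMk_eq S K lam hlam θ k w (torsCoord S K θ k 0) 0
          (by rw [← coe_divPowTors_apply, ← coe_divPowTors_apply, divPowTors_torsCoord, map_zero])]
        change lamPairing S K lam k w 0 = 0
        exact map_zero _
      map_add' := fun m m' ↦ by
        rw [lamPairing_eq_of_divPowCofreeMk_eq S K lam hlam θ k w (torsCoord S K θ k (m + m')) (torsCoord S K θ k m + torsCoord S K θ k m')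
          (by rw [← coe_divPowTors_apply, ← coe_divPowTors_apply, divPowTors_torsCoord, map_add,
            divPowTors_torsCoord, divPowTors_torsCoord])]
        exact map_add _ _ _ }
  map_zero' := AddMonoidHom.ext fun m ↦ by
    show lamPairing S K lam k 0 (torsCoord S K θ k m 0) = 0
    rw [map_zero, AddMonoidHom.zero_apply]
  map_add' := fun w w' ↦ AddMonoidHom.ext fun m ↦ by
    show lamPairing S K lam k (w + w') (torsCoord S K θ k m 0) = lamPairing S K lam k w (torsCoord S K θ k m 0) + lamPairing S K lam k w' (torsCoord S K θ k m 0)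
    rw [map_add, AddMonoidHom.add_apply]

/-- ★ **`⟪w, t/p^k⟫_k = (w, t)_k`**: the torsion-level pairing on the class of `t` is the coordinate trace pairing at `t`. [cite: Rubin2000, §4.2] -/
theorem cofreeLamPairing_divPowTors (w : OMuCarrier K S (p ^ k)) (t : Fin 1 → padicCoeffIntegers S) :
    cofreeLamPairing S K lam hlam θ k w (divPowTors S K θ k t) = lamPairing S K lam k w (t 0) :=
  lamPairing_eq_of_divPowCofreeMk_eq S K lam hlam θ k w _ _ (by
    rw [← coe_divPowTors_apply, ← coe_divPowTors_apply, divPowTors_torsCoord])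

/-! ## §3. The laws on `M[p^k]` -/

/-- ★ **`𝒪`-balance on `M[p^k]`**: `⟪(c ⊗ id) w, m⟫ = ⟪w, c·m⟫` (the shape of the binder `hPsc`). [cite: Rubin2000, §4.2] -/
theorem cofreeLamPairing_oMuScalar (c : padicCoeffIntegers S) (w : OMuCarrier K S (p ^ k)) (m : ↥(torsionPow (Cofree θ (padicCoeffField S)) p k)) :
    cofreeLamPairing S K lam hlam θ k (oMuScalar S (p ^ k) c w) m = cofreeLamPairing S K lam hlam θ k w (c • m) := by
  obtain ⟨t, rfl⟩ := exists_divPowTors_eq S K θ k m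
  rw [smul_divPowTors, cofreeLamPairing_divPowTors, cofreeLamPairing_divPowTors, lamPairing_oMuScalar]
  rfl

/-- ★ **Level law on `M[p^k]`**: `ι(⟪red w, m⟫_k) = ⟪w, incl m⟫_{k+1}` (`red = id ⊗ (ζ ↦ ζ^p)`, `ι : μ_{p^k} ⊆ μ_{p^{k+1}}`, `incl : M[p^k] ⊆ M[p^{k+1}]`) — the shape of the binder `hPred`.
[cite: NeukirchSchmidtWingberg2008, (7.1.4), (7.2.6)] -/
theorem muInclusion_cofreeLamPairing_oMuRed (w : OMuCarrier K S (p ^ (k + 1))) (m : ↥(torsionPow (Cofree θ (padicCoeffField S)) p k)) :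
    (haveI : NeZero (p ^ k) := ⟨pow_ne_zero _ (Fact.out : p.Prime).ne_zero⟩
     haveI : NeZero (p ^ (k + 1)) := ⟨pow_ne_zero _ (Fact.out : p.Prime).ne_zero⟩
     muInclusion K (pow_dvd_pow p (Nat.le_succ k)) (cofreeLamPairing S K lam hlam θ k (oMuRed S k w) m)) =
      cofreeLamPairing S K lam hlam θ (k + 1) w (AddSubgroup.inclusion (torsionPow_mono (M := Cofree θ (padicCoeffField S)) (p := p) (Nat.le_succ k)) m) := by
  obtain ⟨t, rfl⟩ := exists_divPowTors_eq S K θ k m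
  rw [inclusion_divPowTors, cofreeLamPairing_divPowTors, cofreeLamPairing_divPowTors, muInclusion_lamPairing_oMuRed S K lam hlam,
    Pi.smul_apply, nsmul_eq_mul]

/-- ★ **Galois twist law on `M[p^k]`**: if `θ′(σ)·θ(σ)₀₀ = 1` then `⟪σ·w, σ·m⟫ = σ·⟪w, m⟫` (`σ` acting on `𝒪 ⊗ μ ⊗ θ′` by honda's `muTwistO`, on `M[p^k]` through `θ`, on `μ`
through `mu`) — the equivariance making `⟪·,·⟫` a pairing of Galois modules `X_k × M[p^k] → μ_{p^k}`. [cite: Rubin2000, §4.2] [cite: NeukirchSchmidtWingberg2008, (7.2.6)] -/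
theorem cofreeLamPairing_muTwistO_smul [NumberField K] (θ' : absoluteGaloisGroup K →ₜ* (padicCoeffIntegers S)ˣ) (σ : absoluteGaloisGroup K)
    (hσ : ((θ' σ : (padicCoeffIntegers S)ˣ) : padicCoeffIntegers S) * ((θ σ : GL (Fin 1) (padicCoeffIntegers S)) : Matrix (Fin 1) (Fin 1) (padicCoeffIntegers S)) 0 0 = 1)
    (w : OMuCarrier K S (p ^ k)) (m : ↥(torsionPow (Cofree θ (padicCoeffField S)) p k)) :
    (haveI : NeZero (p ^ k) := ⟨pow_ne_zero _ (Fact.out : p.Prime).ne_zero⟩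
     cofreeLamPairing S K lam hlam θ k (muTwistO S θ' k σ w) (σ • m)) =
      (haveI : NeZero (p ^ k) := ⟨pow_ne_zero _ (Fact.out : p.Prime).ne_zero⟩; mu K (p ^ k) σ (cofreeLamPairing S K lam hlam θ k w m)) := by
  haveI : NeZero (p ^ k) := ⟨pow_ne_zero _ (Fact.out : p.Prime).ne_zero⟩
  obtain ⟨t, rfl⟩ := exists_divPowTors_eq S K θ k m
  rw [smul_divPowTors_gal, cofreeLamPairing_divPowTors, cofreeLamPairing_divPowTors,
    show ((((θ σ : GL (Fin 1) (padicCoeffIntegers S)) : Matrix (Fin 1) (Fin 1) (padicCoeffIntegers S)) *ᵥ t) 0) =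
      ((θ σ : GL (Fin 1) (padicCoeffIntegers S)) : Matrix (Fin 1) (Fin 1) (padicCoeffIntegers S)) 0 0 * t 0 by
      rw [Matrix.mulVec, dotProduct, Fin.sum_univ_one],
    lamPairing_muTwistO S lam θ' k σ _ hσ]

end Cofree

end Summit.BirchSwinnertonDyer.BirchSwinnertonDyer.Theorems.SmallImageRttD2Seq

end
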